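/-
Copyright (c) 2026 the pub-hodgecm-mathlib formalisation cell (harness21).  Prover seat hodgecm-mathlib-K2Liu-p10 (g2), Track B «K2-LIT»,
#184♮ = hLiu418 = `stmt-HodgeConjecture-24832`; LEAD F0P6-plan (g12) deal 2026-09-04T07:58:10Z, ROAD Φ row Φ7c (CENSUS-41 §8 ERRATUM
8881a97e035b6652); census memo `K2/K2Liu-p10/g2/CENSUS-Phi7c-GL2BorelEisensteinContinuation.K2Liu-p10-g2.md` b2db9a807d78f02a.
THEOREMS ONLY (no `def`, no `instance`, no named-fact hypothesis, no `sorry`).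
-/
import Literature.NumberTheory.Automorphic.MirabolicEisensteinTwistedBounds
import HarnessLib

/-!
# Crux `HLiu418`, ROAD Φ, organ Φ7c: THE CONTINUED BOREL EISENSTEIN SERIES OF `GL₂(𝔸_L)` (indeed `GL_n`) OF A GODEMENT SECTION —
# meromorphic on `ℂ`, holomorphic off `{0, 1}`, a SIMPLE POLE at `s = 1` with CONSTANT residue, automorphic and continuous in `g`

Cell `hodgecm-mathlib`, crux item hLiu418 = `stmt-HodgeConjecture-24832` (helper lane, count-neutral).  THIN ADAPTER over the tree's ★
mirabolic Eisenstein series of `GL_n` (Cogdell 2004 §2.3 = Jacquet–Shalika 1981 §4 = Tate's thesis on the vector integral):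
★ `MirabolicEisensteinSeries` (`mirabolicEisenstein K ν Φ s g = |det g|^s Σ_{ξ ∈ ℙ^{n−1}(K)} ∫_{𝔸_Kˣ} Φ(a ξ g)|a|^{ns} dν`, re s > 1), ★
`MirabolicEisensteinResidue` (Tate's decomposition, the residue `tendsto_sub_one_mul_mirabolicEisenstein`), ★ `RankinSelbergIntegralEntire`
(`tateNumeratorGL ν μ 𝓕 Φ s g = E*(s, g) := s(s−1)E(g, Φ; s)`, ENTIRE, agreement on re s > 1, continuity in `g`, automorphy for all `s`, local bounds)
and, for a unitary Hecke character non-trivial on `𝔸¹`, ★ `MirabolicEisensteinTwistedContinuation` (`tateNumeratorTwistedGL`, ENTIRE).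
AT `n = 2` THE MIRABOLIC `P′₂ = Z₂·P₂` IS THE BOREL `B`, so `E(g, Φ; s)` IS the `GL₂(𝔸_L)` Borel Eisenstein series of the Godement section
`F(g, Φ; s) = |det g|^s ∫ Φ(a e₂ g)|a|^{2s} dν(a)` (Levi exponents `(s, −s)`, gap `2s`): the middle-cell term `E₁` of CENSUS-41 §8 with its
exponents `(s′+1, −s′)` (gap `2s′+1`) is this series at **`s = s′ + ½ = λ + ½`** — absolutely convergent iff `re s > 1 ⇔ re λ > ½`, pole at
`s = 1 ⇔ λ = ½`, simple, residue a constant functional of `Φ`; the continuation given here is to ALL of `ℂ ∖ {0, 1}` (`⊋ re λ > 0`).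
CONTENTS (general `n ≥ 1`, number field `K`; the consumer takes `K := L`, `n := 2`):
* §1 values of the numerator at the poles: `tateNumerator_one`, **`tateNumeratorGL_one`** (`E*(1, g) = c_D·V·(∫Φ dμ)∕n`, independent of `g`,
  `c_D = μ(Dⁿ)⁻¹`, `V = idelicCovolume ν`), `tateNumeratorGL_zero` (`E*(0, g) = V·Φ(0)∕n`);
* §2 THE CONTINUED SERIES `s ↦ E*(s, g) ∕ (s(s−1))` (written inline, no definition): **`differentiableOn_continuedEisenstein`** (holomorphic on
  `{s ≠ 0, s ≠ 1}`), **`continuedEisenstein_eq_mirabolicEisenstein`** (= `E(g, Φ; s)` on re s > 1), **`tendsto_sub_one_mul_continuedEisenstein`**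
  (SIMPLE POLE at `1`: `(s−1)·E♯(s,g) → c_D·V·(∫Φ)∕n` along `𝓝[≠] 1` — the residue is the CONSTANT functional `Φ ↦ c_D V Φ̂(0)∕n`),
  `tendsto_mul_continuedEisenstein_zero` (the pole at `0`), `continuedEisenstein_rational_mul` (left `GL_n(K)`-invariance for every `s`),
  `continuous_continuedEisenstein` (continuity in `g` off the poles);
* §3 the twisted series (`η` unitary, non-trivial on `𝔸¹`, e.g. the consumer's `χχ^c ≠ 1`): entire — ★ re-exported as `differentiableOn` +
  agreement (`continuedEisensteinTwisted_eq`);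
* §4 the `GL₂` dictionary `s = λ + ½`: **`differentiableOn_continuedEisenstein_two_half_add`** (holomorphic on `{re λ > 0, λ ≠ ½}` — indeed
  on `{λ ≠ ±½}`), **`tendsto_sub_half_mul_continuedEisenstein_two`** (simple pole at `λ = ½`, constant residue), agreement on `re λ > ½`.
Sources: [CogdellAnalyticTheory2004, §2.3 pp. 210–211, Thm. 2.1∕2.2]; [JacquetShalikaAJM1981, §4]; [CasselsFrohlichANT1967, Ch. XV Thm. 4.4.1].
HONEST LABEL.  Helper lemmas, count-neutral; `HC_CM` is proved only modulo the 7 printed citations (2 remaining named inputs: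
hLiu418 = `stmt-HodgeConjecture-24832`, h413 = `stmt-HodgeConjecture-24833`) until rung 0 closes.
-/

set_option autoImplicit false
set_option linter.dupNamespace false -- the mandated namespace repeats `HodgeConjecture.HodgeConjecture`

noncomputable section

namespace Summit.HodgeConjecture.HodgeConjecture.Cruxes.HLiu418.K2LiuGL2BorelEisensteinContinuation

open scoped NNReal ENNReal Topology MatrixGroups
open NumberField IsDedekindDomain MeasureTheory Measure Matrix Filter Set
open Literature.NumberTheory.Automorphic
open Literature.NumberTheory.GaloisRepresentations (HeckeCharacter ideleGroup)

variable {K : Type} [Field K] [NumberField K] {n : ℕ}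
variable [MeasurableSpace (AdeleRing (𝓞 K) K)] [BorelSpace (AdeleRing (𝓞 K) K)]

-- `BorelSpace (ideleGroup K)` is the tree's ★ `borelSpace_ideleGroup` (a `Prop`, so any instance the consumer has in scope fits —
-- the ★ mirabolic files activate it by `attribute [local instance] borelSpace_ideleGroup`); taken here as an instance ARGUMENT.
variable [BorelSpace (ideleGroup K)]
  (ν : Measure (ideleGroup K)) [ν.IsHaarMeasure] (μ : Measure (Fin n → AdeleRing (𝓞 K) K)) [μ.IsAddHaarMeasure]

/-! ## 1. The numerator at the poles -/

omit [ν.IsHaarMeasure] [μ.IsAddHaarMeasure] in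
/-- `tateNumerator ν μ 𝓕 Ψ 1 = c_D · V · Ψ̂(0) ∕ n` (the Tate integrals carry the factor `s(s−1)`, which vanishes at `s = 1`).
[cite: CogdellAnalyticTheory2004, §2.3 p. 211] -/
theorem tateNumerator_one (𝓕 : Set (ideleGroup K)) (Ψ : (Fin n → AdeleRing (𝓞 K) K) → ℂ) :
    tateNumerator ν μ 𝓕 Ψ 1 =
      (((μ (piFundamentalDomain K (Fin n))).toReal⁻¹ : ℝ) : ℂ) * ((idelicCovolume K ν).toReal : ℂ) *
        adelicPiFourier K (Fin n) μ Ψ 0 / n := by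
  simp only [tateNumerator, sub_self, mul_zero, zero_mul, zero_add, mul_one, zero_div, sub_zero]

omit [ν.IsHaarMeasure] [μ.IsAddHaarMeasure] in
/-- `tateNumerator ν μ 𝓕 Ψ 0 = V · Ψ(0) ∕ n`. [cite: CogdellAnalyticTheory2004, §2.3 p. 211] -/
theorem tateNumerator_zero (𝓕 : Set (ideleGroup K)) (Ψ : (Fin n → AdeleRing (𝓞 K) K) → ℂ) :
    tateNumerator ν μ 𝓕 Ψ 0 = ((idelicCovolume K ν).toReal : ℂ) * Ψ 0 / n := by
  simp only [tateNumerator, zero_mul, mul_zero, zero_add, zero_sub, zero_div]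
  ring

omit [ν.IsHaarMeasure] [μ.IsAddHaarMeasure] in
/-- **`E*(0, g) = V · Φ(0) ∕ n`** — independent of `g`. [cite: CogdellAnalyticTheory2004, §2.3 p. 211] -/
theorem tateNumeratorGL_zero (𝓕 : Set (ideleGroup K)) (Φ : (Fin n → AdeleRing (𝓞 K) K) → ℂ) (g : GL (Fin n) (AdeleRing (𝓞 K) K)) :
    tateNumeratorGL ν μ 𝓕 Φ 0 g = ((idelicCovolume K ν).toReal : ℂ) * Φ 0 / n := by
  rw [tateNumeratorGL, Complex.cpow_zero, one_mul, tateNumerator_zero, Matrix.zero_vecMul]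

/-- **`E*(1, g) = c_D · V · (∫ Φ dμ) ∕ n` — the residue of `E(g, Φ; s)` at `s = 1`, INDEPENDENT of `g`** (uniqueness of limits along
`re s > 1`: there `(s − 1)E(g, Φ; s) = E*(s, g)∕s → E*(1, g)`, ★ `tendsto_sub_one_mul_mirabolicEisenstein`).
[cite: CogdellAnalyticTheory2004, §2.3 pp. 210–211] -/
theorem tateNumeratorGL_one (hn : 0 < n) {𝓕 : Set (ideleGroup K)} (h𝓕 : IsIdeleClassDomain K 𝓕)
    {Φ : (Fin n → AdeleRing (𝓞 K) K) → ℂ} (hΦ : Φ ∈ piSchwartzBruhat K (Fin n)) (g : GL (Fin n) (AdeleRing (𝓞 K) K)) :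
    tateNumeratorGL ν μ 𝓕 Φ 1 g =
      (((μ (piFundamentalDomain K (Fin n))).toReal⁻¹ : ℝ) : ℂ) * ((idelicCovolume K ν).toReal : ℂ) * (∫ v, Φ v ∂μ) / n := by
  -- `E*(s, g)/s → E*(1, g)` along `re s > 1`
  have hcont : ContinuousAt (fun s : ℂ => tateNumeratorGL ν μ 𝓕 Φ s g / s) 1 :=
    ((differentiable_tateNumeratorGL ν μ h𝓕 hΦ g 1).continuousAt).div continuousAt_id one_ne_zero
  have h1 : Tendsto (fun s : ℂ => tateNumeratorGL ν μ 𝓕 Φ s g / s) (𝓝[{s : ℂ | 1 < s.re}] 1)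
      (𝓝 (tateNumeratorGL ν μ 𝓕 Φ 1 g)) := by
    have h := hcont.tendsto
    rw [div_one] at h
    exact h.mono_left nhdsWithin_le_nhds
  -- on `re s > 1` it is `(s − 1) E(g, Φ; s)`
  have heq : (fun s : ℂ => (s - 1) * mirabolicEisenstein K ν Φ s g) =ᶠ[𝓝[{s : ℂ | 1 < s.re}] 1]
      fun s : ℂ => tateNumeratorGL ν μ 𝓕 Φ s g / s := by
    filter_upwards [self_mem_nhdsWithin] with s hs
    have hs0 : s ≠ 0 := fun h => by rw [h, Complex.zero_re] at hs; exact (lt_irrefl _ (hs.trans zero_lt_one))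
    rw [tateNumeratorGL_eq_mul_mirabolicEisenstein ν μ hn h𝓕 hΦ hs g]
    field_simp
  have h2 := (tendsto_sub_one_mul_mirabolicEisenstein ν hn μ hΦ g).congr' heq
  haveI : (𝓝[{s : ℂ | 1 < s.re}] (1 : ℂ)).NeBot := by
    refine mem_closure_iff_nhdsWithin_neBot.1 ?_
    have h : (1 : ℂ) ∈ closure {s : ℂ | 1 < s.re} := by
      rw [Complex.closure_setOf_lt_re]
      simp
    exact h
  exact tendsto_nhds_unique h1 h2

/-! ## 2. The continued series `E♯(s, g) = E*(s, g) ∕ (s(s−1))` -/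

omit [BorelSpace (ideleGroup K)] in
/-- **Holomorphy off the poles**: `s ↦ E*(s, g)∕(s(s−1))` is holomorphic on `{s | s ≠ 0 ∧ s ≠ 1}` (hence on the consumer's
`{re s > ½} ∖ {1}`). [cite: CogdellAnalyticTheory2004, §2.3 Thm. 2.2] -/
theorem differentiableOn_continuedEisenstein {𝓕 : Set (ideleGroup K)} (h𝓕 : IsIdeleClassDomain K 𝓕)
    {Φ : (Fin n → AdeleRing (𝓞 K) K) → ℂ} (hΦ : Φ ∈ piSchwartzBruhat K (Fin n)) (g : GL (Fin n) (AdeleRing (𝓞 K) K)) :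
    DifferentiableOn ℂ (fun s : ℂ => tateNumeratorGL ν μ 𝓕 Φ s g / (s * (s - 1))) {s | s ≠ 0 ∧ s ≠ 1} := fun s hs =>
  (((differentiable_tateNumeratorGL ν μ h𝓕 hΦ g s).div ((differentiableAt_id.mul (differentiableAt_id.sub_const 1)))
    (mul_ne_zero hs.1 (sub_ne_zero.2 hs.2))).differentiableWithinAt)

omit [BorelSpace (ideleGroup K)] in
/-- **Agreement with the Eisenstein series on `re s > 1`**: `E*(s, g)∕(s(s−1)) = E(g, Φ; s)`. [cite: CogdellAnalyticTheory2004, §2.3 p. 210] -/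
theorem continuedEisenstein_eq_mirabolicEisenstein (hn : 0 < n) {𝓕 : Set (ideleGroup K)} (h𝓕 : IsIdeleClassDomain K 𝓕)
    {Φ : (Fin n → AdeleRing (𝓞 K) K) → ℂ} (hΦ : Φ ∈ piSchwartzBruhat K (Fin n)) {s : ℂ} (hs : 1 < s.re)
    (g : GL (Fin n) (AdeleRing (𝓞 K) K)) :
    tateNumeratorGL ν μ 𝓕 Φ s g / (s * (s - 1)) = mirabolicEisenstein K ν Φ s g := by
  have hs0 : s ≠ 0 := fun h => by rw [h, Complex.zero_re] at hs; exact lt_irrefl _ (hs.trans zero_lt_one)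
  have hs1 : s - 1 ≠ 0 := sub_ne_zero.2 fun h => by rw [h, Complex.one_re] at hs; exact lt_irrefl _ hs
  rw [tateNumeratorGL_eq_mul_mirabolicEisenstein ν μ hn h𝓕 hΦ hs g, mul_div_cancel_left₀ _ (mul_ne_zero hs0 hs1)]

/-- **THE SIMPLE POLE AT `s = 1` WITH CONSTANT RESIDUE**: `(s − 1)·E♯(s, g) → c_D·V·(∫Φ dμ)∕n` as `s → 1`, `s ≠ 1` — the residue functional
`Φ ↦ c_D V Φ̂(0)∕n` does not depend on `g` («residue = constant functional», CENSUS-41 §8). [cite: CogdellAnalyticTheory2004, §2.3 pp. 210–211] -/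
theorem tendsto_sub_one_mul_continuedEisenstein (hn : 0 < n) {𝓕 : Set (ideleGroup K)} (h𝓕 : IsIdeleClassDomain K 𝓕)
    {Φ : (Fin n → AdeleRing (𝓞 K) K) → ℂ} (hΦ : Φ ∈ piSchwartzBruhat K (Fin n)) (g : GL (Fin n) (AdeleRing (𝓞 K) K)) :
    Tendsto (fun s : ℂ => (s - 1) * (tateNumeratorGL ν μ 𝓕 Φ s g / (s * (s - 1)))) (𝓝[≠] 1)
      (𝓝 ((((μ (piFundamentalDomain K (Fin n))).toReal⁻¹ : ℝ) : ℂ) * ((idelicCovolume K ν).toReal : ℂ) * (∫ v, Φ v ∂μ) / n)) := by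
  rw [← tateNumeratorGL_one ν μ hn h𝓕 hΦ g]
  have hcont : ContinuousAt (fun s : ℂ => tateNumeratorGL ν μ 𝓕 Φ s g / s) 1 :=
    ((differentiable_tateNumeratorGL ν μ h𝓕 hΦ g 1).continuousAt).div continuousAt_id one_ne_zero
  have h1 : Tendsto (fun s : ℂ => tateNumeratorGL ν μ 𝓕 Φ s g / s) (𝓝[≠] 1) (𝓝 (tateNumeratorGL ν μ 𝓕 Φ 1 g)) := by
    have h := hcont.tendsto
    rw [div_one] at h
    exact h.mono_left nhdsWithin_le_nhds
  refine h1.congr' ?_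
  -- `(s − 1)·(N∕(s(s−1))) = N∕s` for `s ≠ 1` near `1` (also `s ≠ 0` there)
  have h0 : ∀ᶠ s : ℂ in 𝓝[≠] 1, s ≠ 0 :=
    (continuousAt_id.eventually_ne one_ne_zero).filter_mono nhdsWithin_le_nhds
  filter_upwards [h0, self_mem_nhdsWithin] with s hs0 hs1
  have hs1' : s - 1 ≠ 0 := sub_ne_zero.2 hs1
  field_simp

/-- The pole at `s = 0`: `s·E♯(s, g) → −V·Φ(0)∕n`. [cite: CogdellAnalyticTheory2004, §2.3 p. 211] -/
theorem tendsto_mul_continuedEisenstein_zero {𝓕 : Set (ideleGroup K)} (h𝓕 : IsIdeleClassDomain K 𝓕)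
    {Φ : (Fin n → AdeleRing (𝓞 K) K) → ℂ} (hΦ : Φ ∈ piSchwartzBruhat K (Fin n)) (g : GL (Fin n) (AdeleRing (𝓞 K) K)) :
    Tendsto (fun s : ℂ => s * (tateNumeratorGL ν μ 𝓕 Φ s g / (s * (s - 1)))) (𝓝[≠] 0)
      (𝓝 (-(((idelicCovolume K ν).toReal : ℂ) * Φ 0 / n))) := by
  have hcont : ContinuousAt (fun s : ℂ => tateNumeratorGL ν μ 𝓕 Φ s g / (s - 1)) 0 :=
    ((differentiable_tateNumeratorGL ν μ h𝓕 hΦ g 0).continuousAt).div (continuousAt_id.sub continuousAt_const)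
      (by rw [zero_sub]; exact neg_ne_zero.2 one_ne_zero)
  have h1 : Tendsto (fun s : ℂ => tateNumeratorGL ν μ 𝓕 Φ s g / (s - 1)) (𝓝[≠] 0)
      (𝓝 (-(((idelicCovolume K ν).toReal : ℂ) * Φ 0 / n))) := by
    have h := hcont.tendsto
    rw [tateNumeratorGL_zero, zero_sub, div_neg, div_one] at h
    exact h.mono_left nhdsWithin_le_nhds
  refine h1.congr' ?_
  have h1' : ∀ᶠ s : ℂ in 𝓝[≠] 0, s ≠ 1 :=
    (continuousAt_id.eventually_ne zero_ne_one).filter_mono nhdsWithin_le_nhds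
  filter_upwards [h1', self_mem_nhdsWithin] with s hs1 hs0
  have hs0' : s ≠ 0 := hs0
  have hs1' : s - 1 ≠ 0 := sub_ne_zero.2 hs1
  field_simp

omit [BorelSpace (ideleGroup K)] in
/-- **Automorphy for every `s`**: `E♯(s, γ g) = E♯(s, g)` for `γ ∈ GL_n(K)` (★ `tateNumeratorGL_mul_of_mem_quotientSubgroup`, the identity
theorem from `re s > 1`). [cite: CogdellAnalyticTheory2004, §2.3 p. 210] -/
theorem continuedEisenstein_rational_mul (hn : 0 < n) {𝓕 : Set (ideleGroup K)}
    (h𝓕 : IsIdeleClassDomain K 𝓕) {Φ : (Fin n → AdeleRing (𝓞 K) K) → ℂ} (hΦ : Φ ∈ piSchwartzBruhat K (Fin n)) (s : ℂ)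
    (γ : GL (Fin n) K) (g : GL (Fin n) (AdeleRing (𝓞 K) K)) :
    tateNumeratorGL ν μ 𝓕 Φ s (Matrix.GeneralLinearGroup.map (algebraMap K (AdeleRing (𝓞 K) K)) γ * g) / (s * (s - 1)) =
      tateNumeratorGL ν μ 𝓕 Φ s g / (s * (s - 1)) := by
  exact congrArg (fun z : ℂ => z / (s * (s - 1)))
    (tateNumeratorGL_mul_of_mem_quotientSubgroup ν μ hn h𝓕 hΦ s
      (h := Matrix.GeneralLinearGroup.map (algebraMap K (AdeleRing (𝓞 K) K)) γ)
      ((AdelicGroupData.gl n K).arithmeticSubgroup_le_quotientSubgroup ⟨γ, rfl⟩) g)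

omit [BorelSpace (ideleGroup K)] in
/-- **Continuity in `g`** off the poles (indeed for every `s`, the numerator being continuous ★ `continuous_tateNumeratorGL`).
[cite: CogdellAnalyticTheory2004, §2.3 p. 211] -/
theorem continuous_continuedEisenstein (hn : 0 < n) {𝓕 : Set (ideleGroup K)} (h𝓕 : IsIdeleClassDomain K 𝓕)
    {Φ : (Fin n → AdeleRing (𝓞 K) K) → ℂ} (hΦ : Φ ∈ piSchwartzBruhat K (Fin n)) (s : ℂ) :
    Continuous fun g : GL (Fin n) (AdeleRing (𝓞 K) K) => tateNumeratorGL ν μ 𝓕 Φ s g / (s * (s - 1)) :=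
  (continuous_tateNumeratorGL ν μ hn h𝓕 hΦ s).div_const _

/-! ## 3. The twisted series: entire -/

omit [BorelSpace (ideleGroup K)] in
/-- **For a unitary Hecke character `η` non-trivial on `𝔸¹` the continued twisted series is ENTIRE** and equals `E(g, Φ; s, η)` on
`re s > 1` (★ `differentiable_tateNumeratorTwistedGL`, ★ `tateNumeratorTwistedGL_eq_mirabolicEisensteinTwisted`, re-exported together: no pole at
all — the consumer's case `χχ^c ≠ 1`). [cite: CogdellAnalyticTheory2004, §2.3 Thm. 2.1] -/
theorem continuedEisensteinTwisted_eq (hn : 0 < n) {𝓕 : Set (ideleGroup K)} (h𝓕 : IsIdeleClassDomain K 𝓕) {η : HeckeCharacter K}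
    (hu : η.IsUnitary) (hη : ∃ b : ideleGroup K, IdeleClassGroup.ideleNorm K b = 1 ∧ η b ≠ 1)
    {Φ : (Fin n → AdeleRing (𝓞 K) K) → ℂ} (hΦ : Φ ∈ piSchwartzBruhat K (Fin n)) (g : GL (Fin n) (AdeleRing (𝓞 K) K)) :
    Differentiable ℂ (fun s : ℂ => tateNumeratorTwistedGL ν μ 𝓕 η Φ s g) ∧
      ∀ s : ℂ, 1 < s.re → tateNumeratorTwistedGL ν μ 𝓕 η Φ s g = mirabolicEisensteinTwisted K ν η Φ s g :=
  ⟨differentiable_tateNumeratorTwistedGL ν μ h𝓕 hu hΦ g, fun _ hs => tateNumeratorTwistedGL_eq_mirabolicEisensteinTwisted ν μ hn h𝓕 hu hη hΦ hs g⟩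

/-! ## 4. `GL₂`: the dictionary `s = λ + ½` of CENSUS-41 §8 -/

omit [BorelSpace (ideleGroup K)] in
/-- **Φ7c at `n = 2`, in the consumer's parameter `λ` (`s = λ + ½`)**: `λ ↦ E♯(λ + ½, g)` is holomorphic on `{λ | λ ≠ −½ ∧ λ ≠ ½}` ⊇
`{re λ > 0} ∖ {½}`. [cite: CogdellAnalyticTheory2004, §2.3 Thm. 2.2] -/
theorem differentiableOn_continuedEisenstein_two_half_add (μ₂ : Measure (Fin 2 → AdeleRing (𝓞 K) K)) [μ₂.IsAddHaarMeasure]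
    {𝓕 : Set (ideleGroup K)} (h𝓕 : IsIdeleClassDomain K 𝓕) {Φ : (Fin 2 → AdeleRing (𝓞 K) K) → ℂ} (hΦ : Φ ∈ piSchwartzBruhat K (Fin 2))
    (g : GL (Fin 2) (AdeleRing (𝓞 K) K)) :
    DifferentiableOn ℂ (fun l : ℂ => tateNumeratorGL ν μ₂ 𝓕 Φ (l + 1 / 2) g / ((l + 1 / 2) * (l + 1 / 2 - 1)))
      {l | l ≠ -(1 / 2) ∧ l ≠ 1 / 2} := by
  intro l hl
  have hmem : l + 1 / 2 ∈ {s : ℂ | s ≠ 0 ∧ s ≠ 1} := by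
    refine ⟨fun h => hl.1 ?_, fun h => hl.2 ?_⟩
    · linear_combination h
    · linear_combination h
  exact ((differentiableOn_continuedEisenstein ν μ₂ h𝓕 hΦ g).differentiableAt
    ((isOpen_ne.inter isOpen_ne).mem_nhds hmem)).comp_differentiableWithinAt l
      ((differentiableAt_id.add_const _).differentiableWithinAt)

omit [BorelSpace (ideleGroup K)] in
/-- `{re λ > 0} ∖ {½}` lies in that domain. [folklore] -/
theorem differentiableOn_continuedEisenstein_two_of_re_pos (μ₂ : Measure (Fin 2 → AdeleRing (𝓞 K) K)) [μ₂.IsAddHaarMeasure]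
    {𝓕 : Set (ideleGroup K)} (h𝓕 : IsIdeleClassDomain K 𝓕) {Φ : (Fin 2 → AdeleRing (𝓞 K) K) → ℂ} (hΦ : Φ ∈ piSchwartzBruhat K (Fin 2))
    (g : GL (Fin 2) (AdeleRing (𝓞 K) K)) :
    DifferentiableOn ℂ (fun l : ℂ => tateNumeratorGL ν μ₂ 𝓕 Φ (l + 1 / 2) g / ((l + 1 / 2) * (l + 1 / 2 - 1)))
      {l | 0 < l.re ∧ l ≠ 1 / 2} :=
  (differentiableOn_continuedEisenstein_two_half_add ν μ₂ h𝓕 hΦ g).mono fun l hl =>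
    ⟨fun h => by
      have : l.re = -(1 / 2 : ℂ).re := by rw [h, Complex.neg_re]
      norm_num at this
      linarith [hl.1], hl.2⟩

omit [BorelSpace (ideleGroup K)] in
/-- **Agreement on `re λ > ½`** with the (absolutely convergent) Borel Eisenstein series of `GL₂`: `E♯(λ + ½, g) = E(g, Φ; λ + ½)`.
[cite: CogdellAnalyticTheory2004, §2.3 p. 210] -/
theorem continuedEisenstein_two_eq (μ₂ : Measure (Fin 2 → AdeleRing (𝓞 K) K)) [μ₂.IsAddHaarMeasure]
    {𝓕 : Set (ideleGroup K)} (h𝓕 : IsIdeleClassDomain K 𝓕) {Φ : (Fin 2 → AdeleRing (𝓞 K) K) → ℂ} (hΦ : Φ ∈ piSchwartzBruhat K (Fin 2))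
    {l : ℂ} (hl : 1 / 2 < l.re) (g : GL (Fin 2) (AdeleRing (𝓞 K) K)) :
    tateNumeratorGL ν μ₂ 𝓕 Φ (l + 1 / 2) g / ((l + 1 / 2) * (l + 1 / 2 - 1)) = mirabolicEisenstein K ν Φ (l + 1 / 2) g :=
  continuedEisenstein_eq_mirabolicEisenstein ν μ₂ two_pos h𝓕 hΦ
    (by rw [Complex.add_re]; norm_num; linarith) g

/-- **The simple pole at `λ = ½` with constant residue**: `(λ − ½)·E♯(λ + ½, g) → c_D·V·(∫Φ dμ)∕2` as `λ → ½`, `λ ≠ ½`.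
[cite: CogdellAnalyticTheory2004, §2.3 pp. 210–211] -/
theorem tendsto_sub_half_mul_continuedEisenstein_two (μ₂ : Measure (Fin 2 → AdeleRing (𝓞 K) K)) [μ₂.IsAddHaarMeasure]
    {𝓕 : Set (ideleGroup K)} (h𝓕 : IsIdeleClassDomain K 𝓕) {Φ : (Fin 2 → AdeleRing (𝓞 K) K) → ℂ} (hΦ : Φ ∈ piSchwartzBruhat K (Fin 2))
    (g : GL (Fin 2) (AdeleRing (𝓞 K) K)) :
    Tendsto (fun l : ℂ => (l - 1 / 2) * (tateNumeratorGL ν μ₂ 𝓕 Φ (l + 1 / 2) g / ((l + 1 / 2) * (l + 1 / 2 - 1)))) (𝓝[≠] (1 / 2))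
      (𝓝 ((((μ₂ (piFundamentalDomain K (Fin 2))).toReal⁻¹ : ℝ) : ℂ) * ((idelicCovolume K ν).toReal : ℂ) * (∫ v, Φ v ∂μ₂) / (2 : ℕ))) := by
  have h := tendsto_sub_one_mul_continuedEisenstein ν μ₂ two_pos h𝓕 hΦ g
  -- substitute `s = λ + ½`
  have hmap : Tendsto (fun l : ℂ => l + 1 / 2) (𝓝[≠] (1 / 2)) (𝓝[≠] 1) := by
    refine tendsto_nhdsWithin_of_tendsto_nhds_of_eventually_within _ ?_ ?_
    · have hc : Tendsto (fun l : ℂ => l + 1 / 2) (𝓝 (1 / 2)) (𝓝 ((1 / 2 : ℂ) + 1 / 2)) :=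
        (continuous_id.add continuous_const).tendsto _
      rw [show (1 / 2 : ℂ) + 1 / 2 = 1 by norm_num] at hc
      exact hc.mono_left nhdsWithin_le_nhds
    · filter_upwards [self_mem_nhdsWithin] with l hl
      intro h1
      have h1' : l + 1 / 2 = 1 := h1
      exact hl (show l = 1 / 2 by linear_combination h1')
  have h2 := h.comp hmap
  refine h2.congr fun l => ?_
  simp only [Function.comp_apply]
  congr 1
  ring

end Summit.HodgeConjecture.HodgeConjecture.Cruxes.HLiu418.K2LiuGL2BorelEisensteinContinuation

end
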